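import Mathlib.Analysis.LocallyConvex.SeparatingDual
import Literature.NumberTheory.LFunctions.MoebiusWalshVaughan
import HarnessLib

/-!
# Vaughan's identity for `μ` against a vector-valued weight: reduction to type-I and type-II block sums (proved)

Everything in this file is PROVED (plus plain definitions). It is the top combinatorial layer
of the Mauduit–Rivat method for the MÖBIUS function in the form used by C. Müllner, *Automatic
sequences fulfill the Sarnak conjecture* (Duke Math. J. 166 (2017)), Thm. 4.4 (= Mauduit–Rivat,
J. Eur. Math. Soc. 17 (2015), Thm. 2), whose §8 reads: "by applying [24, Lemma 1], or its
analogue in the case of `μ` obtained using (13.40) instead of (13.39) from [15]" — [24] =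
Mauduit–Rivat, Ann. of Math. 171 (2010), Lemme 1 (Vaughan-type reduction of
`∑_{x/q < n ≤ x} Λ(n) g(n)` to type-I sums (6) over `M ≤ x^{β₁}` and type-II sums (5) over
`x^{β₁} ≤ M ≤ x^{β₂}`), [15] = Iwaniec–Kowalski. The `μ`-analogue is not written down in print;
this file supplies it, for a weight `g` with values in a real normed space `E` (Müllner needs
matrix values), from the tree's three-term identity
`μ = 2μ_u − (μ_u*μ_u)*1 + G_u*(μ−μ_u)` (`Sieve.MoebiusExpSum.moebius_eq_three_terms`, summed
against a test function in `MoebiusWalshVaughan.sum_moebius_mul_eq_vaughan`):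

* `sum_moebius_smul_eq_vaughan` — the identity for `E`-valued `g` (from the real one by duality);
* `hypCut q x g` — `g` cut to the hyperbolic range `x/q < n ≤ x` of [24, Lemme 1];
  `sum_moebius_smul_hyp_eq` — for `qu ≤ x` the term `2∑ μ_u g` disappears (`n ≤ u ≤ x/q`), so
  `∑_{x/q<n≤x} μ(n) g(n) = −∑_{a,b} c(a) g̃(ab) + ∑_{k,ℓ} G_u(k) β(ℓ) g̃(kℓ)`, `c = μ_u*μ_u`
  (`|c| ≤ τ`, `c = 0` beyond `u²`), `G_u = (μ−μ_u)*1` (`|G_u| ≤ τ`, `0` on `[1,u]`),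
  `β = μ − μ_u`;
* `norm_sum_moebius_smul_hyp_le` — hence
  `‖∑_{x/q<n≤x} μ(n) g(n)‖ ≤ ∑_{a ≤ u²} τ(a) ‖∑_b g̃(ab)‖ + ∑_{u<k≤x} τ(k) ‖∑_ℓ β(ℓ) g̃(kℓ)‖`;
* `blockI`, `blockII` — the base-`q` block quantities (type I: `∑_{q^j ≤ a < q^{j+1}} ‖∑_b g̃(ab)‖`;
  type II in mean-square form: `∑_{q^j ≤ k < q^{j+1}} ‖∑_ℓ b(ℓ) g̃(kℓ)‖²`, which is what the
  Cauchy–Schwarz opening of Mauduit–Rivat's Prop. 2 bounds), and the final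
  `norm_sum_moebius_smul_le_blocks`: the divisor weights are removed by Cauchy–Schwarz and
  `∑_{a ≤ K} τ(a)² ≤ K(1 + log K)³` (`Sieve.Vaughan.sum_sq_card_divisors_le`), so that only
  logarithms are lost (Mauduit–Rivat: "a better exponent of the factor `log x` might be
  obtained with some extra work").

## References
* C. Mauduit, J. Rivat, Ann. of Math. 171 (2010) 1591–1646, §4 Lemme 1 (p. 1598) and its
  proof (pp. 1599–1601). [MauduitRivat2010]
* C. Mauduit, J. Rivat, J. Eur. Math. Soc. 17 (2015) 2595–2642, Thm. 2 and §8 (p. 2628).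
  [MauduitRivat2015]
* C. Müllner, Duke Math. J. 166 (2017), Thm. 4.4 and §5.4. [Mullner2017]
* H. Iwaniec, E. Kowalski, *Analytic Number Theory*, (13.39)–(13.40). [IwaniecKowalski2004]
-/

noncomputable section

open Finset Real ArithmeticFunction
open scoped ArithmeticFunction.Moebius ArithmeticFunction.zeta ArithmeticFunction.sigma

namespace Literature.NumberTheory.LFunctions.MRVaughan

open Literature.NumberTheory.Sieve (moebiusTrunc)
open Literature.NumberTheory.Sieve.Vaughan (gU gU_eq_zero_of_le abs_gU_le sum_sq_card_divisors_le)
open Literature.NumberTheory.LFunctions.MoebiusWalshVaughan (typeICoeff abs_typeICoeff_le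
  typeICoeff_eq_zero typeIICoeffB typeIICoeffB_apply abs_typeIICoeffB_le typeIICoeffB_eq_zero
  sum_moebius_mul_eq_vaughan)

variable {E : Type*} [NormedAddCommGroup E]

/-! ## The hyperbolic cut-off -/

/-- The weight cut to the hyperbolic range `x/q < n ≤ x` (i.e. `x < qn` and `n ≤ x`).
[cite: MauduitRivat2010, Lemme 1] -/
def hypCut (q x : ℕ) (g : ℕ → E) : ℕ → E := fun n => if x < q * n ∧ n ≤ x then g n else 0

/-- Unfolding. [folklore] -/
theorem hypCut_apply (q x : ℕ) (g : ℕ → E) (n : ℕ) :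
    hypCut q x g n = if x < q * n ∧ n ≤ x then g n else 0 := rfl

/-- `‖g̃‖ ≤ ‖g‖`. [folklore] -/
theorem norm_hypCut_le (q x : ℕ) (g : ℕ → E) (n : ℕ) : ‖hypCut q x g n‖ ≤ ‖g n‖ := by
  rw [hypCut_apply]; split_ifs <;> simp

/-- `g̃` vanishes beyond `x`. [folklore] -/
theorem hypCut_eq_zero_of_lt {q x : ℕ} (g : ℕ → E) {n : ℕ} (hn : x < n) : hypCut q x g n = 0 := by
  rw [hypCut_apply, if_neg]; omega

/-- `g̃` vanishes on `qn ≤ x`. [folklore] -/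
theorem hypCut_eq_zero_of_le {q x : ℕ} (g : ℕ → E) {n : ℕ} (hn : q * n ≤ x) :
    hypCut q x g n = 0 := by
  rw [hypCut_apply, if_neg]; omega


variable [NormedSpace ℝ E]

/-! ## The identity for vector-valued weights -/

/-- **Vaughan's three-term identity for `μ` against an `E`-valued weight** supported on
`[1, X]`: `∑_{m≤X} μ(m) g(m) = 2∑ μ_u(m) g(m) − ∑_{a,b ≤ X} c(a) g(ab) + ∑_{k,ℓ ≤ X} G_u(k)β(ℓ) g(kℓ)`
(the real identity `sum_moebius_mul_eq_vaughan` tested against every continuous functional).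
[cite: MauduitRivat2010, Lemme 1 (proof, μ-analogue)] -/
theorem sum_moebius_smul_eq_vaughan (u X : ℕ) {g : ℕ → E} (hg0 : ∀ m, X < m → g m = 0) :
    ∑ m ∈ Ioc 0 X, (μ m : ℝ) • g m =
      (2 : ℝ) • ∑ m ∈ Ioc 0 X, ((moebiusTrunc u : ArithmeticFunction ℝ) m) • g m -
        ∑ a ∈ Ioc 0 X, ∑ b ∈ Ioc 0 X, (typeICoeff u a) • g (a * b) +
        ∑ k ∈ Ioc 0 X, ∑ ℓ ∈ Ioc 0 X, (gU u k * typeIICoeffB u ℓ) • g (k * ℓ) := by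
  apply (SeparatingDual.eq_iff_forall_dual_eq (R := ℝ)).2
  intro φ
  have h := sum_moebius_mul_eq_vaughan u X (g := fun m => φ (g m))
    (fun m hm => by simp only [hg0 m hm, _root_.map_zero])
  simp only [mul_one] at h
  simp only [map_sum, map_smul, map_sub, map_add, smul_eq_mul]
  rw [h]

/-- **The identity on the hyperbolic range** ([24, Lemme 1] for `μ`): for `qu ≤ x` the term
`2 ∑ μ_u g̃` vanishes and
`∑_{x/q<n≤x} μ(n) g(n) = −∑_{a,b≤x} c(a) g̃(ab) + ∑_{k,ℓ≤x} G_u(k) β(ℓ) g̃(kℓ)`.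
[cite: MauduitRivat2010, Lemme 1 (proof, μ-analogue)] -/
theorem sum_moebius_smul_hyp_eq {q x u : ℕ} (hu : q * u ≤ x) (g : ℕ → E) :
    ∑ n ∈ (Ioc 0 x).filter (fun n => x < q * n), (μ n : ℝ) • g n =
      -(∑ a ∈ Ioc 0 x, ∑ b ∈ Ioc 0 x, (typeICoeff u a) • hypCut q x g (a * b)) +
        ∑ k ∈ Ioc 0 x, ∑ ℓ ∈ Ioc 0 x, (gU u k * typeIICoeffB u ℓ) • hypCut q x g (k * ℓ) := by
  have h1 : ∑ n ∈ (Ioc 0 x).filter (fun n => x < q * n), (μ n : ℝ) • g n =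
      ∑ n ∈ Ioc 0 x, (μ n : ℝ) • hypCut q x g n := by
    rw [sum_filter]
    refine sum_congr rfl fun n hn => ?_
    rw [hypCut_apply]
    have hnx : n ≤ x := (mem_Ioc.1 hn).2
    by_cases h : x < q * n
    · rw [if_pos h, if_pos ⟨h, hnx⟩]
    · rw [if_neg h, if_neg (fun h' => h h'.1), smul_zero]
  have h2 : ∑ m ∈ Ioc 0 x, ((moebiusTrunc u : ArithmeticFunction ℝ) m) • hypCut q x g m = 0 := by
    refine sum_eq_zero fun m _ => ?_
    rw [ArithmeticFunction.intCoe_apply, Literature.NumberTheory.Sieve.moebiusTrunc_apply]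
    split_ifs with hm
    · rw [hypCut_eq_zero_of_le g ((Nat.mul_le_mul_left q hm).trans hu), smul_zero]
    · simp
  rw [h1, sum_moebius_smul_eq_vaughan u x (fun m hm => hypCut_eq_zero_of_lt g hm), h2, smul_zero,
    zero_sub, neg_add_eq_sub]

/-- **First bound**: divisor-bounded coefficients out, supports in:
`‖∑_{x/q<n≤x} μ(n) g(n)‖ ≤ ∑_{a ≤ u²} τ(a)‖∑_{b≤x} g̃(ab)‖ + ∑_{u<k≤x} τ(k)‖∑_{ℓ≤x} β(ℓ) g̃(kℓ)‖`.
[cite: MauduitRivat2010, Lemme 1 (proof, μ-analogue: sums S₂, S₃)] -/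
theorem norm_sum_moebius_smul_hyp_le {q x u : ℕ} (hu : q * u ≤ x) (g : ℕ → E) :
    ‖∑ n ∈ (Ioc 0 x).filter (fun n => x < q * n), (μ n : ℝ) • g n‖ ≤
      ∑ a ∈ Ioc 0 (u * u), (σ 0 a : ℝ) * ‖∑ b ∈ Ioc 0 x, hypCut q x g (a * b)‖ +
        ∑ k ∈ Ioc u x, (σ 0 k : ℝ) * ‖∑ ℓ ∈ Ioc 0 x, typeIICoeffB u ℓ • hypCut q x g (k * ℓ)‖ := by
  rw [sum_moebius_smul_hyp_eq hu g]
  refine (norm_add_le _ _).trans (add_le_add ?_ ?_)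
  · -- type I part
    rw [norm_neg]
    calc ‖∑ a ∈ Ioc 0 x, ∑ b ∈ Ioc 0 x, typeICoeff u a • hypCut q x g (a * b)‖
        ≤ ∑ a ∈ Ioc 0 x, ‖∑ b ∈ Ioc 0 x, typeICoeff u a • hypCut q x g (a * b)‖ := norm_sum_le _ _
      _ = ∑ a ∈ Ioc 0 x, |typeICoeff u a| * ‖∑ b ∈ Ioc 0 x, hypCut q x g (a * b)‖ := by
          refine sum_congr rfl fun a _ => ?_
          rw [← smul_sum, norm_smul, Real.norm_eq_abs]
      _ = ∑ a ∈ (Ioc 0 x).filter (fun a => a ≤ u * u),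
            |typeICoeff u a| * ‖∑ b ∈ Ioc 0 x, hypCut q x g (a * b)‖ := by
          rw [sum_filter]
          refine sum_congr rfl fun a _ => ?_
          split_ifs with h
          · rfl
          · rw [typeICoeff_eq_zero (not_le.1 h), abs_zero, zero_mul]
      _ ≤ ∑ a ∈ Ioc 0 (u * u), |typeICoeff u a| * ‖∑ b ∈ Ioc 0 x, hypCut q x g (a * b)‖ := by
          refine sum_le_sum_of_subset_of_nonneg (fun a ha => ?_) (fun _ _ _ => by positivity)
          simp only [mem_filter, mem_Ioc] at ha ⊢
          exact ⟨ha.1.1, ha.2⟩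
      _ ≤ ∑ a ∈ Ioc 0 (u * u), (σ 0 a : ℝ) * ‖∑ b ∈ Ioc 0 x, hypCut q x g (a * b)‖ := by
          gcongr with a _
          exact abs_typeICoeff_le u a
  · -- type II part
    calc ‖∑ k ∈ Ioc 0 x, ∑ ℓ ∈ Ioc 0 x, (gU u k * typeIICoeffB u ℓ) • hypCut q x g (k * ℓ)‖
        ≤ ∑ k ∈ Ioc 0 x, ‖∑ ℓ ∈ Ioc 0 x, (gU u k * typeIICoeffB u ℓ) • hypCut q x g (k * ℓ)‖ :=
          norm_sum_le _ _
      _ = ∑ k ∈ Ioc 0 x, |gU u k| * ‖∑ ℓ ∈ Ioc 0 x, typeIICoeffB u ℓ • hypCut q x g (k * ℓ)‖ := by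
          refine sum_congr rfl fun k _ => ?_
          rw [← Real.norm_eq_abs, ← norm_smul, smul_sum]
          congr 1
          exact sum_congr rfl fun ℓ _ => (mul_smul _ _ _)
      _ = ∑ k ∈ (Ioc 0 x).filter (fun k => u < k),
            |gU u k| * ‖∑ ℓ ∈ Ioc 0 x, typeIICoeffB u ℓ • hypCut q x g (k * ℓ)‖ := by
          rw [sum_filter]
          refine sum_congr rfl fun k _ => ?_
          split_ifs with h
          · rfl
          · rw [gU_eq_zero_of_le (not_lt.1 h), abs_zero, zero_mul]
      _ = ∑ k ∈ Ioc u x, |gU u k| * ‖∑ ℓ ∈ Ioc 0 x, typeIICoeffB u ℓ • hypCut q x g (k * ℓ)‖ := by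
          congr 1
          ext k
          simp only [mem_filter, mem_Ioc]
          omega
      _ ≤ ∑ k ∈ Ioc u x, (σ 0 k : ℝ) * ‖∑ ℓ ∈ Ioc 0 x, typeIICoeffB u ℓ • hypCut q x g (k * ℓ)‖ := by
          gcongr with k _
          exact abs_gU_le u k

/-! ## Base-`q` blocks and Cauchy–Schwarz -/

/-- The type-I block quantity: `∑_{q^j ≤ a < q^{j+1}} ‖∑_{b ≤ x} g̃(ab)‖` (an unweighted type-I
sum over the hyperbolic range, the shape of Mauduit–Rivat's `S_I(ϑ)`).
[cite: MauduitRivat2015, Prop. 1 (the sum S_I)] -/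
def blockI (q x j : ℕ) (g : ℕ → E) : ℝ :=
  ∑ a ∈ Ico (q ^ j) (q ^ (j + 1)), ‖∑ b ∈ Ioc 0 x, hypCut q x g (a * b)‖

/-- The type-II block quantity in mean-square form:
`∑_{q^j ≤ k < q^{j+1}} ‖∑_{ℓ ≤ x} b(ℓ) g̃(kℓ)‖²` (the quantity bounded by the Cauchy–Schwarz
opening `|S_II|² ≤ M ∑_m |∑_n b_n f(mn) e(ϑmn)|²` of Mauduit–Rivat's Prop. 2).
[cite: MauduitRivat2015, Prop. 2 (proof, first display)] -/
def blockII (q x j : ℕ) (b : ℕ → ℝ) (g : ℕ → E) : ℝ :=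
  ∑ k ∈ Ico (q ^ j) (q ^ (j + 1)), ‖∑ ℓ ∈ Ioc 0 x, b ℓ • hypCut q x g (k * ℓ)‖ ^ 2

omit [NormedSpace ℝ E] in
/-- `blockI ≥ 0`. [folklore] -/
theorem blockI_nonneg (q x j : ℕ) (g : ℕ → E) : 0 ≤ blockI q x j g :=
  sum_nonneg fun _ _ => norm_nonneg _

/-- `blockII ≥ 0`. [folklore] -/
theorem blockII_nonneg (q x j : ℕ) (b : ℕ → ℝ) (g : ℕ → E) : 0 ≤ blockII q x j b g :=
  sum_nonneg fun _ _ => sq_nonneg _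

/-- **Splitting `[1, Y]` into base-`q` blocks** (nonnegative summands): 
`∑_{a ≤ Y} F(a) ≤ ∑_{j ≤ log_q Y} ∑_{q^j ≤ a < q^{j+1}} F(a)`. [folklore] -/
theorem sum_Ioc_le_sum_blocks {q : ℕ} (hq : 2 ≤ q) (Y : ℕ) {F : ℕ → ℝ} (hF : ∀ a, 0 ≤ F a) :
    ∑ a ∈ Ioc 0 Y, F a ≤ ∑ j ∈ range (Nat.log q Y + 1), ∑ a ∈ Ico (q ^ j) (q ^ (j + 1)), F a := by
  rw [← sum_fiberwise_of_maps_to (s := Ioc 0 Y) (t := range (Nat.log q Y + 1))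
    (g := fun a => Nat.log q a) (fun a ha => mem_range.2 (Nat.lt_succ_of_le
      (Nat.log_mono_right (mem_Ioc.1 ha).2)))]
  refine sum_le_sum fun j _ => sum_le_sum_of_subset_of_nonneg (fun a ha => ?_) fun _ _ _ => hF _
  rw [mem_filter, mem_Ioc] at ha
  obtain ⟨⟨ha0, -⟩, rfl⟩ := ha
  rw [mem_Ico]
  exact ⟨Nat.pow_log_le_self q (by omega), Nat.lt_pow_succ_log_self hq a⟩

/-- Restricting to blocks meeting `(u, x]`: for nonnegative `F`,
`∑_{u < k ≤ x} F(k) ≤ ∑_{log_q u ≤ j ≤ log_q x} ∑_{q^j ≤ k < q^{j+1}} F(k)`. [folklore] -/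
theorem sum_Ioc_le_sum_blocks_Ico {q : ℕ} (hq : 2 ≤ q) (u x : ℕ) {F : ℕ → ℝ} (hF : ∀ a, 0 ≤ F a) :
    ∑ k ∈ Ioc u x, F k ≤
      ∑ j ∈ Ico (Nat.log q u) (Nat.log q x + 1), ∑ k ∈ Ico (q ^ j) (q ^ (j + 1)), F k := by
  rw [← sum_fiberwise_of_maps_to (s := Ioc u x) (t := Ico (Nat.log q u) (Nat.log q x + 1))
    (g := fun a => Nat.log q a) (fun a ha => ?_)]
  · refine sum_le_sum fun j _ => sum_le_sum_of_subset_of_nonneg (fun a ha => ?_) fun _ _ _ => hF _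
    rw [mem_filter, mem_Ioc] at ha
    obtain ⟨⟨ha0, -⟩, rfl⟩ := ha
    rw [mem_Ico]
    exact ⟨Nat.pow_log_le_self q (by omega), Nat.lt_pow_succ_log_self hq a⟩
  · rw [mem_Ioc] at ha
    rw [mem_Ico]
    exact ⟨Nat.log_mono_right ha.1.le, Nat.lt_succ_of_le (Nat.log_mono_right ha.2)⟩

/-- `∑_{q^j ≤ a < q^{j+1}} τ(a)² ≤ q^{j+1} (1 + log q^{j+1})³`. [folklore] -/
theorem sum_block_sq_card_divisors_le (q j : ℕ) :
    ∑ a ∈ Ico (q ^ j) (q ^ (j + 1)), ((#a.divisors : ℕ) : ℝ) ^ 2 ≤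
      (q : ℝ) ^ (j + 1) * (1 + Real.log ((q : ℝ) ^ (j + 1))) ^ 3 := by
  calc ∑ a ∈ Ico (q ^ j) (q ^ (j + 1)), ((#a.divisors : ℕ) : ℝ) ^ 2
      ≤ ∑ a ∈ Ioc 0 (q ^ (j + 1)), ((#a.divisors : ℕ) : ℝ) ^ 2 := by
        refine sum_le_sum_of_subset_of_nonneg (fun a ha => ?_) fun _ _ _ => by positivity
        rw [mem_Ico] at ha
        rw [mem_Ioc]
        rcases Nat.eq_zero_or_pos a with rfl | ha0
        · -- `a = 0` is in the block only if `q^j = 0`; then `τ(0)² = 0` anyway — but membership: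
          -- we must show `0 < 0`; instead exclude: `q^j ≤ 0` forces nothing useful, so use `omega`
          -- on `0 < q^(j+1)` false? We avoid: `Nat.divisors 0 = ∅` makes the term `0`; but subset
          -- membership is required. Since `q ^ j ≤ 0` means `q = 0`, then `q^(j+1) = 0` and
          -- `0 < 0` fails: contradiction with `ha.2 : 0 < 0`.
          exact absurd ha.2 (by simp_all)
        · exact ⟨ha0, ha.2.le⟩
    _ ≤ (q ^ (j + 1) : ℕ) * (1 + Real.log ((q ^ (j + 1) : ℕ) : ℝ)) ^ 3 := sum_sq_card_divisors_le _
    _ = (q : ℝ) ^ (j + 1) * (1 + Real.log ((q : ℝ) ^ (j + 1))) ^ 3 := by push_cast; ring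

/-- **Cauchy–Schwarz against the divisor function on a block**:
`∑_{block} τ(a) v(a) ≤ √(q^{j+1}(1+log q^{j+1})³) · √(∑_{block} v(a)²)`. [folklore] -/
theorem sum_block_card_divisors_mul_le (q j : ℕ) (v : ℕ → ℝ) :
    ∑ a ∈ Ico (q ^ j) (q ^ (j + 1)), (σ 0 a : ℝ) * v a ≤
      Real.sqrt ((q : ℝ) ^ (j + 1) * (1 + Real.log ((q : ℝ) ^ (j + 1))) ^ 3) *
        Real.sqrt (∑ a ∈ Ico (q ^ j) (q ^ (j + 1)), v a ^ 2) := by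
  refine (Real.sum_mul_le_sqrt_mul_sqrt _ _ _).trans ?_
  gcongr
  refine le_trans (le_of_eq ?_) (sum_block_sq_card_divisors_le q j)
  refine sum_congr rfl fun a _ => ?_
  rw [ArithmeticFunction.sigma_zero_apply]

omit [NormedSpace ℝ E] in
/-- **The trivial bound on a hyperbolic type-I inner sum**: for `‖g‖ ≤ 1` and `q^j ≤ a`,
`‖∑_{b≤x} g̃(ab)‖ ≤ x / q^j` (at most `x/a` values of `b` have `ab ≤ x`). [folklore] -/
theorem norm_sum_hypCut_le {q x j a : ℕ} (hq : 2 ≤ q) (ha : q ^ j ≤ a) {g : ℕ → E}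
    (hg : ∀ n, ‖g n‖ ≤ 1) : ‖∑ b ∈ Ioc 0 x, hypCut q x g (a * b)‖ ≤ (x : ℝ) / q ^ j := by
  have hq0 : 0 < q := by omega
  have ha0 : 0 < a := lt_of_lt_of_le (pow_pos hq0 j) ha
  calc ‖∑ b ∈ Ioc 0 x, hypCut q x g (a * b)‖
      = ‖∑ b ∈ (Ioc 0 x).filter (fun b => a * b ≤ x), hypCut q x g (a * b)‖ := by
        rw [sum_filter]
        congr 1
        refine sum_congr rfl fun b _ => ?_
        split_ifs with h
        · rfl
        · rw [hypCut_eq_zero_of_lt g (not_le.1 h)]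
    _ ≤ ∑ b ∈ (Ioc 0 x).filter (fun b => a * b ≤ x), ‖hypCut q x g (a * b)‖ := norm_sum_le _ _
    _ ≤ ∑ _b ∈ (Ioc 0 x).filter (fun b => a * b ≤ x), (1 : ℝ) :=
        sum_le_sum fun b _ => (norm_hypCut_le q x g _).trans (hg _)
    _ = (((Ioc 0 x).filter (fun b => a * b ≤ x)).card : ℝ) := by simp
    _ ≤ ((x / a : ℕ) : ℝ) := by
        have : (Ioc 0 x).filter (fun b => a * b ≤ x) ⊆ Ioc 0 (x / a) := by
          intro b hb
          rw [mem_filter, mem_Ioc] at hb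
          rw [mem_Ioc, Nat.le_div_iff_mul_le ha0, mul_comm]
          exact ⟨hb.1.1, hb.2⟩
        exact_mod_cast (card_le_card this).trans_eq (Nat.card_Ioc _ _)
    _ ≤ (x : ℝ) / a := Nat.cast_div_le
    _ ≤ (x : ℝ) / q ^ j := by
        have : (0 : ℝ) < (q : ℝ) ^ j := by positivity
        exact div_le_div_of_nonneg_left (Nat.cast_nonneg x) this (by exact_mod_cast ha)

omit [NormedSpace ℝ E] in
/-- Mean square from sup times sum on a type-I block:
`∑_{block} ‖∑_b g̃(ab)‖² ≤ (x/q^j) · blockI`. [folklore] -/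
theorem sum_block_norm_sq_le {q x j : ℕ} (hq : 2 ≤ q) {g : ℕ → E} (hg : ∀ n, ‖g n‖ ≤ 1) :
    ∑ a ∈ Ico (q ^ j) (q ^ (j + 1)), ‖∑ b ∈ Ioc 0 x, hypCut q x g (a * b)‖ ^ 2 ≤
      (x : ℝ) / q ^ j * blockI q x j g := by
  rw [blockI, mul_sum]
  refine sum_le_sum fun a ha => ?_
  rw [sq]
  exact mul_le_mul_of_nonneg_right (norm_sum_hypCut_le hq (mem_Ico.1 ha).1 hg) (norm_nonneg _)

/-- The type-I block also in mean-square (type-II) form with `b = 1`. [folklore] -/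
theorem sum_block_norm_sq_eq_blockII (q x j : ℕ) (g : ℕ → E) :
    ∑ a ∈ Ico (q ^ j) (q ^ (j + 1)), ‖∑ b ∈ Ioc 0 x, hypCut q x g (a * b)‖ ^ 2 =
      blockII q x j (fun _ => 1) g := by
  simp only [blockII, one_smul]

/-! ## The reduction to block quantities -/

/-- **The `μ`-analogue of Mauduit–Rivat 2010, Lemme 1, in base-`q` blocks.** For `q ≥ 2`,
`qu ≤ x` and an `E`-valued weight with `‖g‖ ≤ 1`:
`‖∑_{x/q<n≤x} μ(n) g(n)‖ ≤ ∑_{j ≤ log_q u²} √(q^{j+1}(1+log q^{j+1})³) √(min((x/q^j) blockI_j, blockII_j(1)))`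
`+ ∑_{log_q u ≤ j ≤ log_q x} √(q^{j+1}(1+log q^{j+1})³) √(blockII_j(β_u))`,
where `blockI_j` is the unweighted type-I sum over the block `[q^j, q^{j+1})` and the hyperbolic
range, and `blockII_j(b)` the mean square over the block of the type-II inner sums with
coefficients `b` (`b = 1` or `b = β_u = μ 𝟙_{>u}`, both `1`-bounded). The `min` lets each block
be treated as type I (Mauduit–Rivat's Prop. 1, `M ≤ (MN)^{1/3}`) or as type II (Prop. 2).
[cite: MauduitRivat2010, Lemme 1 (μ-analogue); MauduitRivat2015, §8] -/
theorem norm_sum_moebius_smul_le_blocks {q x u : ℕ} (hq : 2 ≤ q) (hu : q * u ≤ x)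
    {g : ℕ → E} (hg : ∀ n, ‖g n‖ ≤ 1) :
    ‖∑ n ∈ (Ioc 0 x).filter (fun n => x < q * n), (μ n : ℝ) • g n‖ ≤
      ∑ j ∈ range (Nat.log q (u * u) + 1),
          Real.sqrt ((q : ℝ) ^ (j + 1) * (1 + Real.log ((q : ℝ) ^ (j + 1))) ^ 3) *
            Real.sqrt (min ((x : ℝ) / q ^ j * blockI q x j g) (blockII q x j (fun _ => 1) g)) +
      ∑ j ∈ Ico (Nat.log q u) (Nat.log q x + 1),
          Real.sqrt ((q : ℝ) ^ (j + 1) * (1 + Real.log ((q : ℝ) ^ (j + 1))) ^ 3) *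
            Real.sqrt (blockII q x j (typeIICoeffB u) g) := by
  refine (norm_sum_moebius_smul_hyp_le hu g).trans (add_le_add ?_ ?_)
  · -- type I coefficients: split into blocks, Cauchy–Schwarz on each block
    refine (sum_Ioc_le_sum_blocks hq (u * u) (fun a => by positivity)).trans (sum_le_sum fun j _ => ?_)
    refine (sum_block_card_divisors_mul_le q j _).trans ?_
    gcongr
    rw [le_min_iff]
    exact ⟨sum_block_norm_sq_le hq hg, (sum_block_norm_sq_eq_blockII q x j g).le⟩
  · -- type II part
    refine (sum_Ioc_le_sum_blocks_Ico hq u x (fun a => by positivity)).trans (sum_le_sum fun j _ => ?_)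
    refine (sum_block_card_divisors_mul_le q j _).trans (le_of_eq ?_)
    rfl

end Literature.NumberTheory.LFunctions.MRVaughan
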